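import Summits.BirchSwinnertonDyer.BirchSwinnertonDyer.Theorems.RamifiedSevenEllipticUnitsLemmaXiGoodPlaces
import Summits.BirchSwinnertonDyer.BirchSwinnertonDyer.Theorems.RamifiedSevenEllipticUnitsLemmaXi
import Literature.NumberTheory.EllipticCurves.HeckeGrossencharakterFunctionalEquation
import HarnessLib

set_option linter.dupNamespace false
set_option autoImplicit false

/-!
# Lemma Ξ, kernel side (VII): ASSEMBLY — clauses (P1) and (P5) for a Rubin datum whose character has
# Deuring's shape (conjugation-equivariant, values = embedded generators)

Helper file for the K7r Value crux `EllipticUnitValueSevenOfGZK` (stmt-BirchSwinnertonDyer-19945), line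
`rubin-formula-zp` v4/v4.1, stub `stub_rubinPackageSevenZp`, clauses (P1) `R.ξ = φ(φ∘c)⁻¹` and (P5)
`‖avatarValueAt R.r γ − 1‖² = p⁻¹`. This file composes files (I) `…LemmaXiAvatarNorm`, (II) `…LemmaXi`,
(III) `…LemmaXiRamifiedValues`, (VI) `…LemmaXiGoodPlaces` into ONE theorem whose hypotheses are the
printed shape of Deuring's theorem for a CM curve `E/ℚ` with CM by `𝒪_K`, `K` imaginary quadratic of
class number one with `𝒪_K^× = {±1}` and `p ∣ d_K` odd (𝒞₇: `K = ℚ(√−7)`, `p = 7`):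
(ii) `φ` is conjugation-equivariant (`IsHeckeConjEquivariant c φ`, Silverman ATAEC II Thm. 9.2 /
Li–Xu §1.1), and (vi) off a finite set of places `φ` is unramified at `w` with
`φ(ϖ_w) = σ'(α_w)` for a generator `α_w` of `w` and a fixed embedding `σ' : K → ℂ` with
`\overline{σ'(x)} = σ'(cx)` (Silverman II Cor. 10.4.1 (a): `ψ(𝔓)𝒪_K = N𝔓`) — the clause the cell asked
the typing layer to expose (planner W50). CONCLUSION (`RubinPadicLFunctionData.ξ_eq_φac_and_norm_sq_of_deuringShape`):
(P1) AND (P5), for every `ℤ_p`-extension `κ` with topological generator `γ`. The EQUALITY place of (P5)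
comes from Landau's theorem (file (VI)), so NO density hypothesis and NO twist-invariance input remain.

References: Silverman, *Advanced Topics*, II Thm. 9.2, Cor. 10.4.1; Landau 1918 §1; [BKNO]
arXiv:2608.06879 Def. 4.2, Def. 4.7.
-/

noncomputable section

open scoped Classical NNReal Topology Pointwise ComplexConjugate
open NumberField IsDedekindDomain Field
  Literature.NumberTheory.EllipticCurves
  Literature.NumberTheory.EllipticCurves.BurungaleKobayashiNakamuraOta2026
  Literature.NumberTheory.GaloisRepresentations

namespace Summit.BirchSwinnertonDyer.BirchSwinnertonDyer.Theorems.RamifiedSevenEllipticUnits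

namespace LemmaXi

variable {K : Type} [Field K] [NumberField K] {p : ℕ} [hp : Fact p.Prime]

/-- **`ι⁻¹(φ_ac(ϖ_w)) = τ(α/cα)` for a conjugation-equivariant `φ` with `φ(ϖ_w) = σ'(α)`**, where
`τ = ι⁻¹ ∘ σ'` and `\overline{σ'(x)} = σ'(cx)` (no unramifiedness needed:
`IsHeckeConjEquivariant.valueAtUniformizer_galConj'`). [cite: SilvermanATAEC1994, Ch. II Thm. 9.2 and Cor. 10.4.1 (a)] -/
theorem symm_φac_valueAtUniformizer_eq_of_conjEquivariant (c : K ≃ₐ[ℚ] K) (ι : PadicAlgCl p ≃+* ℂ)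
    (σ' : K →+* ℂ) (hσ' : ∀ x : K, conj (σ' x) = σ' (c x)) {φ : HeckeCharacter K}
    (heq : IsHeckeConjEquivariant c φ) {w : HeightOneSpectrum (𝓞 K)} {α : 𝓞 K}
    (hφw : φ.valueAtUniformizer w = σ' (α : K)) :
    ι.symm ((φ * (HeckeCharacter.galConj c φ)⁻¹).valueAtUniformizer w) =
      (ι.symm.toRingHom.comp σ') ((α : K) / c (α : K)) := by
  rw [HeckeCharacter.valueAtUniformizer_mul', HeckeCharacter.valueAtUniformizer_inv',
    heq.valueAtUniformizer_galConj', hφw, hσ', ← map_inv₀, ← map_mul, ← div_eq_mul_inv]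
  rfl

/-- **`\overline{σ'(x)} = σ'(cx)`** for a non-real embedding `σ'` of a quadratic field and `c ≠ 1`
(the three embeddings `σ'`, `\overline{σ'}`, `σ' ∘ c` among the TWO embeddings of `K`, Mathlib
`NumberField.Embeddings.card`). For an imaginary quadratic `K` every `σ'` is non-real. [folklore] -/
theorem conj_embedding_eq_embedding_algEquiv (h2 : Module.finrank ℚ K = 2) (c : K ≃ₐ[ℚ] K)
    (hc : c ≠ 1) (σ' : K →+* ℂ) (hσ' : ¬ ComplexEmbedding.IsReal σ') (x : K) :
    conj (σ' x) = σ' (c x) := by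
  classical
  set σ₁ : K →+* ℂ := ComplexEmbedding.conjugate σ' with hσ₁
  set σ₂ : K →+* ℂ := σ'.comp (c : K →+* K) with hσ₂
  have h1 : σ₁ ≠ σ' := fun h ↦ hσ' (ComplexEmbedding.isReal_iff.mpr h)
  have h2' : σ₂ ≠ σ' := by
    intro h
    apply hc
    ext y
    have := congrArg (fun f : K →+* ℂ ↦ f y) h
    simp only [hσ₂, RingHom.coe_comp, Function.comp_apply] at this
    exact σ'.injective this
  have hcard : Fintype.card (K →+* ℂ) = 2 := by rw [Embeddings.card, h2]
  have h12 : σ₁ = σ₂ := by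
    by_contra hne
    have h3 : ({σ', σ₁, σ₂} : Finset (K →+* ℂ)).card = 3 := by
      rw [Finset.card_insert_of_notMem, Finset.card_pair hne]
      simp only [Finset.mem_insert, Finset.mem_singleton, not_or]
      exact ⟨h1.symm, h2'.symm⟩
    have := Finset.card_le_univ ({σ', σ₁, σ₂} : Finset (K →+* ℂ))
    rw [h3, hcard] at this
    omega
  have := congrArg (fun f : K →+* ℂ ↦ f x) h12
  simpa [hσ₁, hσ₂, ComplexEmbedding.conjugate_coe_eq] using this

omit hp in
/-- A generator of a place `w ∤ p` is prime to `𝔭 ∋ p`. [folklore] -/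
theorem not_mem_of_span_eq {𝔭 w : HeightOneSpectrum (𝓞 K)} (hp𝔭 : ((p : ℕ) : 𝓞 K) ∈ 𝔭.asIdeal)
    (hpw : ((p : ℕ) : 𝓞 K) ∉ w.asIdeal) {α : 𝓞 K} (hα : Ideal.span {α} = w.asIdeal) :
    α ∉ 𝔭.asIdeal := by
  intro h
  have hle : w.asIdeal ≤ 𝔭.asIdeal := by rw [← hα]; exact (Ideal.span_singleton_le_iff_mem _).mpr h
  have heqw : w.asIdeal = 𝔭.asIdeal := (w.isMaximal.eq_of_le 𝔭.isPrime.ne_top hle)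
  exact hpw (heqw ▸ hp𝔭)

/-- In a domain whose only units are `±1`, two generators of the same principal ideal agree up to sign,
so `α/cα` does not depend on the generator. [folklore] -/
theorem div_smul_eq_of_span_eq (c : K ≃ₐ[ℚ] K) (hunits : ∀ u : (𝓞 K)ˣ, (u : 𝓞 K) = 1 ∨ (u : 𝓞 K) = -1)
    {α x : 𝓞 K} (h : Ideal.span {α} = Ideal.span {x}) :
    (α : K) / c (α : K) = (x : K) / c (x : K) := by
  obtain ⟨u, hu⟩ := Ideal.span_singleton_eq_span_singleton.mp h
  rcases hunits u with h1 | h1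
  · rw [← hu, h1, mul_one]
  · rw [← hu, h1, mul_neg, mul_one]
    simp [neg_div, div_neg]

end LemmaXi

/-! ## (P1) ∧ (P5) from Deuring's shape -/

section Datum

open LemmaXi

variable {W : WeierstrassCurve ℚ} [W.IsElliptic] {p : ℕ} [hp : Fact p.Prime]
  {K : Type} [Field K] [NumberField K] {c : K ≃ₐ[ℚ] K} {𝔭 : HeightOneSpectrum (𝓞 K)}
  {κ : ZpExtension K p} {γ : absoluteGaloisGroup K} {ι : PadicAlgCl p ≃+* ℂ} {φ : HeckeCharacter K}
  {Ω : ℂ} {𝓔 : AcDualExpSystem W p K 𝔭 κ ι} {D : EllipticUnitClassData W p K 𝔭 κ γ ι φ Ω 𝓔}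

/-- **(P1) ∧ (P5) for a Rubin datum over a character of DEURING SHAPE.** `K` quadratic with
`𝒪_K^× = {±1}`, `θ ∈ 𝒪_K` with `θ² = −p` (`p ∣ d_K` odd, `𝔭 ∋ p`), `c ≠ 1`, `σ' : K → ℂ` with
`\overline{σ'(x)} = σ'(cx)`; `φ` conjugation-equivariant and, off a finite set, unramified at `w` with
`φ(ϖ_w) = σ'(α_w)`, `(α_w) = w` (Deuring: Silverman II Thm. 9.2, Cor. 10.4.1 (a)). Then for every Rubin
`p`-adic `L`-function datum `R` over `φ` ([BKNO] Def. 4.7): `R.ξ = φ(φ∘c)⁻¹` (P1) and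
`‖avatarValueAt R.r γ − 1‖² = p⁻¹` (P5). Proof: all Frobenius values `τ(α_w/cα_w)` lie within
`p^{−1/2}` of `1` (file (III)); LEMMA Ξ (file (II)); one place off the exceptional set achieves the bound
(file (VI): Landau 1918 in the narrow ray class of `(1 + θ)` mod `p𝓞_K`; generators agree up to `±1`);
file (I). [cite: BurungaleKobayashiNakamuraOta2026, Def. 4.2 and Def. 4.7 (arXiv:2608.06879 pp. 24, 27) (claim; preprint; fields of the datum)]
[cite: SilvermanATAEC1994, Ch. II Thm. 9.2 and Cor. 10.4.1 (a)] [cite: Landau1918Idealklassen, §1 Satz] -/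
theorem RubinPadicLFunctionData.ξ_eq_φac_and_norm_sq_of_deuringShape [Fact (κ.IsTopGenerator γ)]
    (R : RubinPadicLFunctionData W p K c 𝔭 κ γ ι φ Ω 𝓔 D)
    (h2 : Module.finrank ℚ K = 2) (hdvd : (p : ℤ) ∣ NumberField.discr K)
    (hp𝔭 : ((p : ℕ) : 𝓞 K) ∈ 𝔭.asIdeal) (hp2 : p ≠ 2) (hc : c ≠ 1)
    (hunits : ∀ u : (𝓞 K)ˣ, (u : 𝓞 K) = 1 ∨ (u : 𝓞 K) = -1)
    {θ : 𝓞 K} (hθ : θ ^ 2 = -((p : ℕ) : 𝓞 K))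
    (σ' : K →+* ℂ) (hσ' : ∀ x : K, conj (σ' x) = σ' (c x)) (heq : IsHeckeConjEquivariant c φ)
    (hvals : ∃ S : Set (HeightOneSpectrum (𝓞 K)), S.Finite ∧ ∀ w ∉ S,
      φ.IsUnramifiedAt w ∧ ∃ α : 𝓞 K, Ideal.span {α} = w.asIdeal ∧ φ.valueAtUniformizer w = σ' (α : K)) :
    R.ξ = φ * (HeckeCharacter.galConj c φ)⁻¹ ∧ ‖avatarValueAt R.r γ - 1‖ ^ 2 = ((p : ℝ))⁻¹ := by
  obtain ⟨S, hS, hS'⟩ := hvals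
  -- enlarge `S` by the (finitely many) places above `p`
  set S' : Set (HeightOneSpectrum (𝓞 K)) := S ∪ {v | ((p : ℕ) : 𝓞 K) ∈ v.asIdeal} with hS'def
  have hS'fin : S'.Finite := hS.union (finite_setOf_natCast_mem (K := K) p)
  let τ : K →+* PadicAlgCl p := ι.symm.toRingHom.comp σ'
  -- the uniform bound at every `w ∉ S'`
  have hall : ∀ w ∉ S', ((p : ℕ) : 𝓞 K) ∉ w.asIdeal ∧
      (φ * (HeckeCharacter.galConj c φ)⁻¹).IsUnramifiedAt w ∧
      ‖((ι.symm ((φ * (HeckeCharacter.galConj c φ)⁻¹).valueAtUniformizer w) : PadicAlgCl p) :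
        ℂ_[p]) - 1‖ ^ 2 ≤ ((p : ℝ))⁻¹ := by
    intro w hw
    rw [hS'def, Set.mem_union, not_or] at hw
    obtain ⟨hwS, hpw⟩ := hw
    simp only [Set.mem_setOf_eq] at hpw
    obtain ⟨hunr, α, hαw, hφw⟩ := hS' w hwS
    refine ⟨hpw, hunr.mul' ((heq.isUnramifiedAt_galConj_iff' w).mpr hunr).inv', ?_⟩
    rw [symm_φac_valueAtUniformizer_eq_of_conjEquivariant c ι σ' hσ' heq hφw]
    exact norm_embedding_div_smul_sub_one_sq_le h2 hdvd 𝔭 hp𝔭 c τ (not_mem_of_span_eq hp𝔭 hpw hαw)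
  have hp1 : ((p : ℝ))⁻¹ < 1 := inv_lt_one_of_one_lt₀ (by exact_mod_cast hp.out.one_lt)
  -- (P1)
  have hP1 : R.ξ = φ * (HeckeCharacter.galConj c φ)⁻¹ :=
    RubinPadicLFunctionData.ξ_eq_φac R ⟨S', hS'fin, fun w hw ↦
      ⟨(hall w hw).2.1, norm_lt_one_of_sq_le (hall w hw).2.2 hp1⟩⟩
  refine ⟨hP1, ?_⟩
  -- the equality place (Landau) for (P5)
  obtain ⟨w₀, hw₀S', hpw₀, x, hw₀x, hx, hxnorm⟩ :=
    exists_goodPlace_of_sq_eq_neg h2 hdvd 𝔭 hp𝔭 hp2 c hc τ hθ S' hS'fin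
  have hw₀S : w₀ ∉ S := fun h ↦ hw₀S' (Set.mem_union_left _ h)
  obtain ⟨hunr₀, α₀, hα₀w, hφw₀⟩ := hS' w₀ hw₀S
  have hone : ‖((ι.symm ((φ * (HeckeCharacter.galConj c φ)⁻¹).valueAtUniformizer w₀) :
      PadicAlgCl p) : ℂ_[p]) - 1‖ ^ 2 = ((p : ℝ))⁻¹ := by
    rw [symm_φac_valueAtUniformizer_eq_of_conjEquivariant c ι σ' hσ' heq hφw₀,
      div_smul_eq_of_span_eq c hunits (hα₀w.trans hw₀x)]
    exact hxnorm
  exact RubinPadicLFunctionData.norm_avatarValueAt_sub_one_sq_eq_of_φac R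
    ⟨S', hS'fin, fun w hw ↦ hall w hw⟩
    ⟨w₀, hpw₀, hunr₀.mul' ((heq.isUnramifiedAt_galConj_iff' w₀).mpr hunr₀).inv', hone⟩

end Datum

end Summit.BirchSwinnertonDyer.BirchSwinnertonDyer.Theorems.RamifiedSevenEllipticUnits

end
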